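import Summits.AtomisticToContinuum.FouriersLaw.Theses.EmbeddedDrudeMourre
import Summits.AtomisticToContinuum.FouriersLaw.Theorems.FGRGap.Negative.LoadBearing
import Literature.Analysis.Calculus.SubmersionNullPreimage
import Mathlib.Analysis.Calculus.FDeriv.Analytic
import Mathlib.MeasureTheory.Measure.OpenPos

/-!
# FGRGap, line fold-jet-rigidity, stub S2 (averaging bootstrap) — file D:
# a continuous a.e.-representative of a null vector is a collisional invariant everywhere

Support file for `stub_nullVectorRegularity` of crux `EmbeddedDrudeMourre.FGRGap`
(item stmt-AtomisticToContinuum-12595). If `f` (periodic) satisfies the four-point identity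
`f k₁ + f (h k₁ k₃) = f k₃ + f (k₁ + h k₁ k₃ - k₃)` a.e. in the plane and `g` is a continuous
`2π`-periodic function with `f = g` a.e., then `g` is a collisional invariant at EVERY real
resonance: off the equal-velocity curve the analytic lifts `φ` of `h` and `k₁ + φ - k₃` are
submersions (their gradients `((v₄-v₁), (v₃-v₄))/(v₂-v₄)`, `((v₂-v₁), (v₃-v₂))/(v₂-v₄)` vanish
only if `v₁ = v₃`), so they pull null sets back to null sets and the identity passes to `g` a.e.,
hence everywhere by continuity; the remaining resonances (diagonal, exchange root, trivial branch
on the equal-velocity curve) are identities by periodicity.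
-/

noncomputable section

open MeasureTheory Set Real Filter Topology
open scoped ENNReal
open Literature.MathematicalPhysics.KineticTheory.PhononBoltzmann
open Summit.AtomisticToContinuum.FouriersLaw.Theorems.FGRGap

namespace Summit.AtomisticToContinuum.FouriersLaw.Theorems.FGRGap.FoldJetRigidity.Bootstrap

/-! ## Linear functionals on the plane -/

/-- A non-zero linear functional `a dk₁ + b dk₃` on `ℝ²` is onto. -/
theorem range_smul_fst_add_smul_snd {a b : ℝ} (hab : a ≠ 0 ∨ b ≠ 0) :
    LinearMap.range ((a • ContinuousLinearMap.fst ℝ ℝ ℝ + b • ContinuousLinearMap.snd ℝ ℝ ℝ :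
      ℝ × ℝ →L[ℝ] ℝ) : ℝ × ℝ →ₗ[ℝ] ℝ) = ⊤ := by
  refine LinearMap.range_eq_top.2 fun t => ?_
  rcases hab with ha | hb
  · refine ⟨(t / a, 0), ?_⟩
    simp only [ContinuousLinearMap.coe_coe, add_apply,
      FunLike.coe_smul, Pi.smul_apply, ContinuousLinearMap.coe_fst',
      ContinuousLinearMap.coe_snd', smul_eq_mul, mul_zero, add_zero]
    field_simp
  · refine ⟨(0, t / b), ?_⟩
    simp only [ContinuousLinearMap.coe_coe, add_apply,
      FunLike.coe_smul, Pi.smul_apply, ContinuousLinearMap.coe_fst',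
      ContinuousLinearMap.coe_snd', smul_eq_mul, mul_zero, zero_add]
    field_simp

/-- The derivative of `k₄ = k₁ + φ - k₃` in normal form. -/
theorem fst_add_sub_snd_eq (A B : ℝ) :
    (ContinuousLinearMap.fst ℝ ℝ ℝ + (A • ContinuousLinearMap.fst ℝ ℝ ℝ +
        B • ContinuousLinearMap.snd ℝ ℝ ℝ) - ContinuousLinearMap.snd ℝ ℝ ℝ : ℝ × ℝ →L[ℝ] ℝ) =
      (1 + A) • ContinuousLinearMap.fst ℝ ℝ ℝ + (B - 1) • ContinuousLinearMap.snd ℝ ℝ ℝ := by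
  ext <;> simp

/-! ## Null sets pulled back along the coordinate projections -/

/-- Preimages of Lebesgue-null sets of `ℝ` under the two coordinate projections of `ℝ²` are
null. -/
theorem volume_preimage_fst_snd_null {N : Set ℝ} (hN : volume N = 0) :
    volume (Prod.fst ⁻¹' N : Set (ℝ × ℝ)) = 0 ∧ volume (Prod.snd ⁻¹' N : Set (ℝ × ℝ)) = 0 := by
  rw [Measure.volume_eq_prod]
  exact ⟨Measure.quasiMeasurePreserving_fst.preimage_null hN,
    Measure.quasiMeasurePreserving_snd.preimage_null hN⟩

/-! ## The identity at non-trivial resonances -/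

/-- `Ω` is `2π`-periodic in `k₂`. -/
theorem resonanceFn_add_int_mul (ω₂ k₁ k₂ k₃ : ℝ) (n : ℤ) :
    resonanceFn ω₂ k₁ (k₂ + n * (2 * π)) k₃ = resonanceFn ω₂ k₁ k₂ k₃ := by
  unfold resonanceFn
  rw [(dispersion_periodic ω₂).int_mul n k₂,
    show k₁ + (k₂ + n * (2 * π)) - k₃ = k₁ + k₂ - k₃ + n * (2 * π) by ring,
    (dispersion_periodic ω₂).int_mul n (k₁ + k₂ - k₃)]

/-- **Passing the a.e. identity to every non-trivial resonance.** Off the equal-velocity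
curve, a continuous periodic a.e.-representative `g` of `f` satisfies
`g k₁ + g (h k₁ k₃) = g k₃ + g (k₁ + h k₁ k₃ - k₃)` (submersion pull-back of null sets along
the analytic lifts, then continuity on the open lift neighbourhood). -/
theorem bracket_eq_of_velocity_ne {ω₂ : ℝ} {h : ℝ → ℝ → ℝ}
    (h_jac : ∀ k₁ k₃ : ℝ, groupVelocity ω₂ k₃ ≠ groupVelocity ω₂ k₁ →
      groupVelocity ω₂ (h k₁ k₃) ≠ groupVelocity ω₂ (k₁ + h k₁ k₃ - k₃))
    (h_lift : ∀ k₁ k₃ : ℝ, groupVelocity ω₂ k₃ ≠ groupVelocity ω₂ k₁ →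
      ∃ (φ : ℝ × ℝ → ℝ) (U : Set (ℝ × ℝ)), U ∈ 𝓝 (k₁, k₃) ∧ AnalyticOnNhd ℝ φ U ∧
        φ (k₁, k₃) = h k₁ k₃ ∧ (∀ p ∈ U, ∃ n : ℤ, φ p = h p.1 p.2 + n * (2 * π)) ∧
        (∀ p ∈ U, groupVelocity ω₂ p.2 ≠ groupVelocity ω₂ p.1) ∧
        (∀ p ∈ U, HasStrictFDerivAt φ
          (((groupVelocity ω₂ (p.1 + φ p - p.2) - groupVelocity ω₂ p.1) /
            (groupVelocity ω₂ (φ p) - groupVelocity ω₂ (p.1 + φ p - p.2))) •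
              ContinuousLinearMap.fst ℝ ℝ ℝ +
          ((groupVelocity ω₂ p.2 - groupVelocity ω₂ (p.1 + φ p - p.2)) /
            (groupVelocity ω₂ (φ p) - groupVelocity ω₂ (p.1 + φ p - p.2))) •
              ContinuousLinearMap.snd ℝ ℝ ℝ) p))
    {f g : ℝ → ℝ} (hf_per : Function.Periodic f (2 * π))
    (hg : Continuous g) (hfg : ∀ᵐ x : ℝ, f x = g x)
    (hae : ∀ᵐ p : ℝ × ℝ, f p.1 + f (h p.1 p.2) = f p.2 + f (p.1 + h p.1 p.2 - p.2))
    {k₁ k₃ : ℝ} (hv : groupVelocity ω₂ k₃ ≠ groupVelocity ω₂ k₁) :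
    g k₁ + g (h k₁ k₃) = g k₃ + g (k₁ + h k₁ k₃ - k₃) := by
  obtain ⟨φ, U, hU, hφ, hφ0, hlift, hcurve, hder⟩ := h_lift k₁ k₃ hv
  set V : Set (ℝ × ℝ) := interior U with hV
  have hVo : IsOpen V := isOpen_interior
  have hpV : (k₁, k₃) ∈ V := mem_interior_iff_mem_nhds.2 hU
  have hVU : V ⊆ U := interior_subset
  have hφV : ContDiffOn ℝ 1 φ V := (hφ.mono hVU).contDiffOn hVo.uniqueDiffOn
  set κ : ℝ × ℝ → ℝ := fun p => p.1 + φ p - p.2 with hκ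
  have hκV : ContDiffOn ℝ 1 κ V := (contDiffOn_fst.add hφV).sub contDiffOn_snd
  have hvper := groupVelocity_periodic ω₂
  -- non-degeneracy of the two gradients on `V`
  have hgrad : ∀ p ∈ V,
      LinearMap.range (fderiv ℝ φ p : ℝ × ℝ →ₗ[ℝ] ℝ) = ⊤ ∧
      LinearMap.range (fderiv ℝ κ p : ℝ × ℝ →ₗ[ℝ] ℝ) = ⊤ := by
    intro p hp
    have hpU := hVU hp
    have hd := (hder p hpU).hasFDerivAt
    obtain ⟨n, hn⟩ := hlift p hpU
    set v₁ := groupVelocity ω₂ p.1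
    set v₂ := groupVelocity ω₂ (φ p)
    set v₃ := groupVelocity ω₂ p.2
    set v₄ := groupVelocity ω₂ (p.1 + φ p - p.2)
    have h13 : v₃ ≠ v₁ := hcurve p hpU
    have h24 : v₂ - v₄ ≠ 0 := by
      have hj := h_jac p.1 p.2 h13
      have e2 : v₂ = groupVelocity ω₂ (h p.1 p.2) := by
        show groupVelocity ω₂ (φ p) = _
        rw [hn]; exact hvper.int_mul n _
      have e4 : v₄ = groupVelocity ω₂ (p.1 + h p.1 p.2 - p.2) := by
        show groupVelocity ω₂ (p.1 + φ p - p.2) = _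
        rw [hn, show p.1 + (h p.1 p.2 + n * (2 * π)) - p.2 =
          p.1 + h p.1 p.2 - p.2 + n * (2 * π) by ring]
        exact hvper.int_mul n _
      rw [e2, e4]
      exact sub_ne_zero.2 hj
    constructor
    · rw [hd.fderiv]
      apply range_smul_fst_add_smul_snd
      by_contra hcon
      push Not at hcon
      obtain ⟨hA, hB⟩ := hcon
      rw [div_eq_zero_iff] at hA hB
      have hA' := hA.resolve_right h24
      have hB' := hB.resolve_right h24
      exact h13 (by linarith [sub_eq_zero.1 hA', sub_eq_zero.1 hB'])
    · have hdκ : HasFDerivAt κ _ p := (hasFDerivAt_fst.add hd).sub hasFDerivAt_snd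
      rw [hdκ.fderiv, fst_add_sub_snd_eq]
      apply range_smul_fst_add_smul_snd
      by_contra hcon
      push Not at hcon
      obtain ⟨hA, hB⟩ := hcon
      have hA' : v₄ - v₁ = -(v₂ - v₄) := by
        have : (v₄ - v₁) / (v₂ - v₄) = -1 := by linarith
        rw [div_eq_iff h24] at this
        linarith
      have hB' : v₃ - v₄ = v₂ - v₄ := by
        have : (v₃ - v₄) / (v₂ - v₄) = 1 := by linarith
        rw [div_eq_iff h24] at this
        linarith
      exact h13 (by linarith)
  -- the four null sets
  set N : Set ℝ := {x | f x ≠ g x} with hN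
  have hN0 : volume N = 0 := by
    rw [hN]
    have := hfg
    rw [ae_iff] at this
    simpa using this
  obtain ⟨n1, n2⟩ := volume_preimage_fst_snd_null hN0
  have n3 : volume (V ∩ φ ⁻¹' N) = 0 :=
    Literature.Analysis.Calculus.measure_inter_preimage_null_of_submersion volume volume hVo
      hφV (fun p hp => (hgrad p hp).1) hN0
  have n4 : volume (V ∩ κ ⁻¹' N) = 0 :=
    Literature.Analysis.Calculus.measure_inter_preimage_null_of_submersion volume volume hVo
      hκV (fun p hp => (hgrad p hp).2) hN0
  -- the identity for `g` a.e. on `V`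
  set G : ℝ × ℝ → ℝ := fun p => g p.1 + g (φ p) - g p.2 - g (κ p) with hG
  have hGae : ∀ᵐ p : ℝ × ℝ, p ∈ V → G p = 0 := by
    filter_upwards [hae, measure_eq_zero_iff_ae_notMem.1 n1, measure_eq_zero_iff_ae_notMem.1 n2,
      measure_eq_zero_iff_ae_notMem.1 n3, measure_eq_zero_iff_ae_notMem.1 n4]
      with p h0 h1 h2 h3 h4 hpV
    have e1 : f p.1 = g p.1 := by simpa [hN] using h1
    have e2 : f p.2 = g p.2 := by simpa [hN] using h2
    have e3 : f (φ p) = g (φ p) := by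
      by_contra hne; exact h3 ⟨hpV, hne⟩
    have e4 : f (κ p) = g (κ p) := by
      by_contra hne; exact h4 ⟨hpV, hne⟩
    obtain ⟨n, hn⟩ := hlift p (hVU hpV)
    have e5 : f (φ p) = f (h p.1 p.2) := by rw [hn]; exact hf_per.int_mul n _
    have e6 : f (κ p) = f (p.1 + h p.1 p.2 - p.2) := by
      simp only [hκ, hn]
      rw [show p.1 + (h p.1 p.2 + n * (2 * π)) - p.2 = p.1 + h p.1 p.2 - p.2 + n * (2 * π) by
        ring]
      exact hf_per.int_mul n _
    simp only [hG]
    rw [← e1, ← e2, ← e3, ← e4, e5, e6]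
    linarith
  -- continuity, hence the identity everywhere on `V`
  have hφc : ContinuousOn φ V := hφV.continuousOn
  have hGc : ContinuousOn G V := by
    refine ((hg.comp_continuousOn continuousOn_fst).add (hg.comp_continuousOn hφc)).sub
      (hg.comp_continuousOn continuousOn_snd) |>.sub (hg.comp_continuousOn ?_)
    exact (continuousOn_fst.add hφc).sub continuousOn_snd
  have hEq : EqOn G (fun _ => 0) V :=
    Measure.eqOn_open_of_ae_eq ((ae_restrict_iff' hVo.measurableSet).2 hGae) hVo hGc
      continuousOn_const
  have h0 := hEq hpV
  simp only [hG, hκ, hφ0] at h0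
  linarith

/-- **The representative is a collisional invariant at every real resonance** (two-root
structure + trivial branch on the equal-velocity curve + periodicity for the trivial
resonances, `bracket_eq_of_velocity_ne` for the non-trivial ones). -/
theorem isCollisionalInvariant_of_ae {ω₂ : ℝ} {h : ℝ → ℝ → ℝ}
    (h_two : ∀ k₁ k₃ : ℝ, (∀ n : ℤ, k₃ - k₁ ≠ n * (2 * π)) →
      resonantSet ω₂ k₁ k₃ = {toIocMod Real.two_pi_pos (-π) k₃, h k₁ k₃})
    (h_triv : ∀ k₁ k₃ : ℝ, (∀ n : ℤ, k₃ - k₁ ≠ n * (2 * π)) →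
      (h k₁ k₃ = toIocMod Real.two_pi_pos (-π) k₃ ↔ groupVelocity ω₂ k₃ = groupVelocity ω₂ k₁))
    (h_jac : ∀ k₁ k₃ : ℝ, groupVelocity ω₂ k₃ ≠ groupVelocity ω₂ k₁ →
      groupVelocity ω₂ (h k₁ k₃) ≠ groupVelocity ω₂ (k₁ + h k₁ k₃ - k₃))
    (h_lift : ∀ k₁ k₃ : ℝ, groupVelocity ω₂ k₃ ≠ groupVelocity ω₂ k₁ →
      ∃ (φ : ℝ × ℝ → ℝ) (U : Set (ℝ × ℝ)), U ∈ 𝓝 (k₁, k₃) ∧ AnalyticOnNhd ℝ φ U ∧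
        φ (k₁, k₃) = h k₁ k₃ ∧ (∀ p ∈ U, ∃ n : ℤ, φ p = h p.1 p.2 + n * (2 * π)) ∧
        (∀ p ∈ U, groupVelocity ω₂ p.2 ≠ groupVelocity ω₂ p.1) ∧
        (∀ p ∈ U, HasStrictFDerivAt φ
          (((groupVelocity ω₂ (p.1 + φ p - p.2) - groupVelocity ω₂ p.1) /
            (groupVelocity ω₂ (φ p) - groupVelocity ω₂ (p.1 + φ p - p.2))) •
              ContinuousLinearMap.fst ℝ ℝ ℝ +
          ((groupVelocity ω₂ p.2 - groupVelocity ω₂ (p.1 + φ p - p.2)) /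
            (groupVelocity ω₂ (φ p) - groupVelocity ω₂ (p.1 + φ p - p.2))) •
              ContinuousLinearMap.snd ℝ ℝ ℝ) p))
    {f g : ℝ → ℝ} (hf_per : Function.Periodic f (2 * π)) (hg_per : Function.Periodic g (2 * π))
    (hg : Continuous g) (hfg : ∀ᵐ x : ℝ, f x = g x)
    (hae : ∀ᵐ p : ℝ × ℝ, f p.1 + f (h p.1 p.2) = f p.2 + f (p.1 + h p.1 p.2 - p.2)) :
    IsCollisionalInvariant ω₂ g := by
  intro k₁ k₂ k₃ hres
  by_cases hdiag : ∃ n : ℤ, k₃ - k₁ = n * (2 * π)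
  · -- the diagonal: `k₃ ≡ k₁`, `k₄ ≡ k₂`
    obtain ⟨n, hn⟩ := hdiag
    have e3 : g k₃ = g k₁ := by
      rw [show k₃ = k₁ + n * (2 * π) by linarith]; exact hg_per.int_mul n _
    have e4 : g (k₁ + k₂ - k₃) = g k₂ := by
      rw [show k₁ + k₂ - k₃ = k₂ - n * (2 * π) by linarith]; exact hg_per.sub_int_mul_eq n
    rw [e3, e4, add_comm]
  · push Not at hdiag
    -- reduce `k₂` to the cell
    set m : ℤ := toIocDiv Real.two_pi_pos (-π) k₂ with hm
    have hk₂ : toIocMod Real.two_pi_pos (-π) k₂ = k₂ - m * (2 * π) := by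
      rw [← self_sub_toIocDiv_zsmul, zsmul_eq_mul]
    have hmem : toIocMod Real.two_pi_pos (-π) k₂ ∈ resonantSet ω₂ k₁ k₃ := by
      refine ⟨by simpa only [show -π + 2 * π = π by ring] using
        toIocMod_mem_Ioc Real.two_pi_pos (-π) k₂, ?_⟩
      rw [hk₂, show k₂ - m * (2 * π) = k₂ + ((-m : ℤ) : ℝ) * (2 * π) by push_cast; ring,
        resonanceFn_add_int_mul]
      exact (resonanceFn_eq_zero_iff ω₂).2 hres
    -- the identity for a cell representative `k₂'` of `k₂` implies the identity for `k₂`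
    suffices key : g k₁ + g (toIocMod Real.two_pi_pos (-π) k₂) =
        g k₃ + g (k₁ + toIocMod Real.two_pi_pos (-π) k₂ - k₃) by
      rw [hk₂, hg_per.sub_int_mul_eq m,
        show k₁ + (k₂ - m * (2 * π)) - k₃ = k₁ + k₂ - k₃ - m * (2 * π) by ring,
        hg_per.sub_int_mul_eq m] at key
      exact key
    -- the exchange root
    have hexch : ∀ k₂' : ℝ, k₂' = toIocMod Real.two_pi_pos (-π) k₃ →
        g k₁ + g k₂' = g k₃ + g (k₁ + k₂' - k₃) := by
      intro k₂' hk
      set m' : ℤ := toIocDiv Real.two_pi_pos (-π) k₃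
      have hk₃ : toIocMod Real.two_pi_pos (-π) k₃ = k₃ - m' * (2 * π) := by
        rw [← self_sub_toIocDiv_zsmul, zsmul_eq_mul]
      rw [hk, hk₃, hg_per.sub_int_mul_eq m',
        show k₁ + (k₃ - m' * (2 * π)) - k₃ = k₁ - m' * (2 * π) by ring,
        hg_per.sub_int_mul_eq m', add_comm]
    rw [h_two k₁ k₃ hdiag] at hmem
    rcases hmem with h1 | h2
    · exact hexch _ h1
    · rw [mem_singleton_iff] at h2
      by_cases hv : groupVelocity ω₂ k₃ = groupVelocity ω₂ k₁
      · exact hexch _ (h2.trans ((h_triv k₁ k₃ hdiag).2 hv))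
      · rw [h2]
        exact bracket_eq_of_velocity_ne h_jac h_lift hf_per hg hfg hae hv

end Summit.AtomisticToContinuum.FouriersLaw.Theorems.FGRGap.FoldJetRigidity.Bootstrap

namespace Summit.AtomisticToContinuum.FouriersLaw.Theorems.FGRGap.FoldJetRigidity

/-- **Helper stub D of `stub_nullVectorRegularity` (line fold-jet-rigidity): the continuous
representative is a collisional invariant everywhere.** Given the two-root structure, the
trivial branch exactly on the equal-velocity curve, the non-degenerate resolved Jacobian and the
analytic lifts, if `f` satisfies the four-point identity a.e. in the plane and `g` is a
continuous `2π`-periodic function with `f = g` a.e., then `g` is a collisional invariant at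
every real resonance (submersion pull-back of null sets along the lifts + continuity;
periodicity for the trivial resonances). -/
theorem stub_nullVectorRegularity_partD :
    ∀ ω₂ : ℝ, ∀ h : ℝ → ℝ → ℝ, (∀ k₁ k₃ : ℝ, (∀ n : ℤ, k₃ - k₁ ≠ n * (2 * π)) → resonantSet ω₂ k₁ k₃ = {toIocMod Real.two_pi_pos (-π) k₃, h k₁ k₃}) → (∀ k₁ k₃ : ℝ, (∀ n : ℤ, k₃ - k₁ ≠ n * (2 * π)) → (h k₁ k₃ = toIocMod Real.two_pi_pos (-π) k₃ ↔ groupVelocity ω₂ k₃ = groupVelocity ω₂ k₁)) → (∀ k₁ k₃ : ℝ, groupVelocity ω₂ k₃ ≠ groupVelocity ω₂ k₁ → groupVelocity ω₂ (h k₁ k₃) ≠ groupVelocity ω₂ (k₁ + h k₁ k₃ - k₃)) → (∀ k₁ k₃ : ℝ, groupVelocity ω₂ k₃ ≠ groupVelocity ω₂ k₁ → ∃ (φ : ℝ × ℝ → ℝ) (U : Set (ℝ × ℝ)), U ∈ 𝓝 (k₁, k₃) ∧ AnalyticOnNhd ℝ φ U ∧ φ (k₁, k₃) = h k₁ k₃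 ∧ (∀ p ∈ U, ∃ n : ℤ, φ p = h p.1 p.2 + n * (2 * π)) ∧ (∀ p ∈ U, groupVelocity ω₂ p.2 ≠ groupVelocity ω₂ p.1) ∧ (∀ p ∈ U, HasStrictFDerivAt φ (((groupVelocity ω₂ (p.1 + φ p - p.2) - groupVelocity ω₂ p.1) / (groupVelocity ω₂ (φ p) - groupVelocity ω₂ (p.1 + φ p - p.2))) • ContinuousLinearMap.fst ℝ ℝ ℝ + ((groupVelocity ω₂ p.2 - groupVelocity ω₂ (p.1 + φ p - p.2)) / (groupVelocity ω₂ (φ p) - groupVelocity ω₂ (p.1 + φ p - p.2))) • ContinuousLinearMap.snd ℝ ℝ ℝ) p)) → ∀ f g : ℝ → ℝ, Function.Periodic f (2 * π) → Function.Periodic g (2 * π) → Continuous g → (∀ᵐ x : ℝ, f x = g x) → (∀ᵐ p : ℝ × ℝ, f p.1 + f (h p.1 p.2) = f p.2 + f (p.1 + h p.1 p.2 - p.2)) → IsCollisionalInvariant ω₂ g :=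
  fun _ω₂ _h h_two h_triv h_jac h_lift _f _g hf_per hg_per hg hfg hae =>
    Bootstrap.isCollisionalInvariant_of_ae h_two h_triv h_jac h_lift hf_per hg_per hg hfg hae

end Summit.AtomisticToContinuum.FouriersLaw.Theorems.FGRGap.FoldJetRigidity

end
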